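import Literature.Analysis.FluidPDE.FluidComputer.ThresholdLevelTableU
import HarnessLib

/-!
# Kernel run of the re-cut table over the 10⁻² box, chunks 4 … 7 (bp3 gen 13, layer 4: robustness variant U)

HONEST FRAMING: low prior, high value-of-information experiment on Tao's machine paradigm; NOT a
claim that NS blows up.

Four kernel evaluations (`decide +kernel`; no `native_decide`, no extra axioms) of the checker
`runSteps` (`ThresholdLevelCheck.lean`) with the interval gate data `GIu` (all seven data within
relative `10⁻²`) on ≤ 25 steps of `ThresholdLevelTableU.stepsU` at a time, from `Bu i` towards the next chunk's
first level, returning `Bu (i+1)` (`Bu 0 = ThresholdLevelTable.Bc0`).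
-/

namespace Literature.Analysis.FluidPDE.FluidComputer

namespace ThresholdLevelTableU

open ThresholdLevelTable (Bc0 RbIt)

set_option maxHeartbeats 10000000 in
set_option maxRecDepth 200000 in
/-- Chunk 4 of the re-cut table run over the 10⁻² box (steps 100 … 124). [folklore] -/
theorem runU4 : runSteps 60 12 3 GIu RbIt Bu4 chunkU4 727446385283287 = some Bu5 := by
  decide +kernel

set_option maxHeartbeats 10000000 in
set_option maxRecDepth 200000 in
/-- Chunk 5 of the re-cut table run over the 10⁻² box (steps 125 … 149). [folklore] -/
theorem runU5 : runSteps 60 12 3 GIu RbIt Bu5 chunkU5 793600105752233 = some Bu6 := by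
  decide +kernel

set_option maxHeartbeats 10000000 in
set_option maxRecDepth 200000 in
/-- Chunk 6 of the re-cut table run over the 10⁻² box (steps 150 … 174). [folklore] -/
theorem runU6 : runSteps 60 12 3 GIu RbIt Bu6 chunkU6 865780318298700 = some Bu7 := by
  decide +kernel

set_option maxHeartbeats 10000000 in
set_option maxRecDepth 200000 in
/-- Chunk 7 of the re-cut table run over the 10⁻² box (steps 175 … 199). [folklore] -/
theorem runU7 : runSteps 60 12 3 GIu RbIt Bu7 chunkU7 944514078370851 = some Bu8 := by
  decide +kernel

end ThresholdLevelTableU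

end Literature.Analysis.FluidPDE.FluidComputer
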